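import Literature.Probability.Percolation.ArmSeparationSlotDefs
import Literature.Probability.Percolation.ArmSeparationProofs
import HarnessLib

/-!
# Slot events: monotonicity and supports

Topic: Probability / Percolation; family `crit-perc`. A brick of the discharge of
`Literature.Probability.Percolation.Nolin2008_twoArm_separation` (Nolin 2008, Thm. 11
[arXiv 0711.4948: Thm. 10], `j = 2`, `σ = BW`; `ArmSeparation.lean`), landing step of the internal
extremities (Nolin 2008, Prop. 12 [arXiv Prop. 11], whose probabilistic engine is Lemma 13
[arXiv Lemma 12]: the generalised FKG inequality for events `A⁺, Ã⁺` increasing and `A⁻, Ã⁻`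
decreasing on disjoint finite supports). For a slot `σ` (`ArmSeparationSlotDefs.lean`) the four
events are `A⁺ = blackArm σ`, `A⁻ = whiteArm σ`, `Ã⁺ = blackCorr σ`, `Ã⁻ = whiteCorr σ`; this file
proves their monotonicity and exhibits finite supports: the **shared support**
`sharedFin m R = {m ≤ |v| ≤ R}` (outer free spaces, the annulus, the tips' protections), the
**private supports** `Slot.Pfin` (`frameIso io` of the slot frame box and the spoke, the arc, the
approach and target boxes) and `Slot.Mfin` (the reflection of the same for the closed arm).

* `intTipOK_mono/congr`, `IntFencedArm.mapMono/congr`, `openVCrossThrough_mono/congr`;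
* `isUpperSet_blackArm`, `isLowerSet_whiteArm`, `isUpperSet_corrEvent`, `isLowerSet_whiteCorr`;
* `slotFrame`, `sharedFin`, `corrFin`, `Slot.Pfin`, `Slot.Mfin`;
* `determinedBy_corrEvent`, `determinedBy_blackCorr`, `determinedBy_whiteCorr`,
  `determinedBy_blackArm`, `determinedBy_whiteArm`.

## References

* P. Nolin, *Near-critical percolation in two dimensions*, Electron. J. Probab. 13 (2008), §4.3
  Prop. 12, Lemma 13, §4.4 [arXiv 0711.4948: Prop. 11, Lemma 12, Thm. 10]. [Nolin2008]
* H. Kesten, *Scaling relations for 2D-percolation*, Comm. Math. Phys. 109 (1987), Lemma 2, §2. [Kesten1987]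
-/

noncomputable section

open Set

namespace Literature.Probability.Percolation

open LatticeModels HalfAnnulus Tube

/-! ### Transport of fenced tips and free-space crossings -/

/-- A fenced tip stays fenced when sites open (the crossing is open, the protections forbid closed paths). [folklore] -/
theorem intTipOK_mono {m k : ℕ} {z mm : Site 2} {χ χ' : SiteConfig (Site 2)} (h : χ ≤ χ') (hT : IntTipOK m z k χ mm) :
    IntTipOK m z k χ' mm := by
  obtain ⟨⟨bb, tt, hbb, htt, P1, P2⟩, hprot⟩ := hT
  refine ⟨⟨bb, tt, hbb, htt, P1.mono fun _ hv => ⟨hv.1, h hv.2⟩, P2.mono fun _ hv => ⟨hv.1, h hv.2⟩⟩, fun q t hq hqb ht hp => ?_⟩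
  exact hprot q t hq hqb ht (hp.mono fun _ hv => ⟨hv.1, fun hv' => hv.2 (h hv')⟩)

/-- A fenced tip is a property of the configuration on the fence strip and on `HA(m)`. [folklore] -/
theorem intTipOK_congr {m k : ℕ} {z mm : Site 2} {χ χ' : SiteConfig (Site 2)}
    (h : ∀ v ∈ triStrip (z 0 - 2 * k) (z 1 + k) k k ∪ haSet m, v ∈ χ ↔ v ∈ χ') (hT : IntTipOK m z k χ mm) :
    IntTipOK m z k χ' mm := by
  obtain ⟨⟨bb, tt, hbb, htt, P1, P2⟩, hprot⟩ := hT
  refine ⟨⟨bb, tt, hbb, htt, P1.mono fun v hv => ⟨hv.1, (h v (Or.inl hv.1)).1 hv.2⟩,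
    P2.mono fun v hv => ⟨hv.1, (h v (Or.inl hv.1)).1 hv.2⟩⟩, fun q t hq hqb ht hp => ?_⟩
  exact hprot q t hq hqb ht (hp.mono fun v hv => ⟨hv.1, fun hv' => hv.2 ((h v (Or.inr hv.1)).1 hv')⟩)

/-- A free space crossed through `u` stays so when sites open. [folklore] -/
theorem openVCrossThrough_mono {F : Set (Site 2)} {lo hi : ℤ} {ω ω' : SiteConfig (Site 2)} {u : Site 2} (h : ω ≤ ω')
    (hc : OpenVCrossThrough F lo hi ω u) : OpenVCrossThrough F lo hi ω' u := by
  obtain ⟨b, t, hb, ht, P1, P2⟩ := hc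
  exact ⟨b, t, hb, ht, P1.mono fun _ hv => ⟨hv.1, h hv.2⟩, P2.mono fun _ hv => ⟨hv.1, h hv.2⟩⟩

/-- A free space crossed through `u` is a property of the configuration on the free space. [folklore] -/
theorem openVCrossThrough_congr {F : Set (Site 2)} {lo hi : ℤ} {ω ω' : SiteConfig (Site 2)} {u : Site 2}
    (h : ∀ v ∈ F, v ∈ ω ↔ v ∈ ω') (hc : OpenVCrossThrough F lo hi ω u) : OpenVCrossThrough F lo hi ω' u := by
  obtain ⟨b, t, hb, ht, P1, P2⟩ := hc
  exact ⟨b, t, hb, ht, P1.mono fun v hv => ⟨hv.1, (h v hv.1).1 hv.2⟩, P2.mono fun v hv => ⟨hv.1, (h v hv.1).1 hv.2⟩⟩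

namespace IntFencedArm

variable {m k₀ K R₀ : ℕ} {A : Set (Site 2)} {χ χ' : SiteConfig (Site 2)}

/-- **Opening sites keeps a fenced arm** (same tip, scale, fence site and far end). [folklore] -/
def mapMono (h : χ ≤ χ') (F : IntFencedArm m A k₀ K R₀ χ) : IntFencedArm m A k₀ K R₀ χ' where
  z := F.z
  j := F.j
  mm := F.mm
  b := F.b
  z_isIntJ := F.z_isIntJ
  z_mid := F.z_mid
  j_lt := F.j_lt
  b_far := F.b_far
  tipOK := intTipOK_mono h F.tipOK
  path := F.path.mono fun _ hv => ⟨hv.1, h hv.2⟩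
  path_tip := F.path_tip.mono fun _ hv => ⟨hv.1, h hv.2⟩

/-- **A fenced arm is a property of the configuration on its region, `HA(m)`, its fence zone and
its fence strip.** [folklore] -/
def congr (F : IntFencedArm m A k₀ K R₀ χ)
    (h : ∀ v ∈ A ∪ haSet m ∪ intFrameZone m F.z F.k ∪ triStrip (F.z 0 - 2 * F.k) (F.z 1 + F.k) F.k F.k, v ∈ χ ↔ v ∈ χ') :
    IntFencedArm m A k₀ K R₀ χ' where
  z := F.z
  j := F.j
  mm := F.mm
  b := F.b
  z_isIntJ := F.z_isIntJ
  z_mid := F.z_mid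
  j_lt := F.j_lt
  b_far := F.b_far
  tipOK := intTipOK_congr (fun v hv => h v (hv.elim (fun hv => Or.inr hv) fun hv => Or.inl (Or.inl (Or.inr hv)))) F.tipOK
  path := F.path.mono fun v hv => ⟨hv.1, (h v (hv.1.elim (fun h' => Or.inl (Or.inl (Or.inl h'))) fun h' => Or.inl (Or.inr h'))).1 hv.2⟩
  path_tip := F.path_tip.mono fun v hv => ⟨hv.1, (h v (Or.inl (Or.inl (Or.inl hv.1)))).1 hv.2⟩

omit χ' in
/-- `mapMono` keeps the data. [folklore] -/
@[simp] theorem mapMono_data {χ' : SiteConfig (Site 2)} (h : χ ≤ χ') (F : IntFencedArm m A k₀ K R₀ χ) :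
    (F.mapMono h).z = F.z ∧ (F.mapMono h).j = F.j ∧ (F.mapMono h).b = F.b := ⟨rfl, rfl, rfl⟩

/-- `congr` keeps the data. [folklore] -/
@[simp] theorem congr_data (F : IntFencedArm m A k₀ K R₀ χ)
    (h : ∀ v ∈ A ∪ haSet m ∪ intFrameZone m F.z F.k ∪ triStrip (F.z 0 - 2 * F.k) (F.z 1 + F.k) F.k F.k, v ∈ χ ↔ v ∈ χ') :
    (F.congr h).z = F.z ∧ (F.congr h).j = F.j ∧ (F.congr h).b = F.b := ⟨rfl, rfl, rfl⟩

end IntFencedArm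

/-! ### Monotonicity -/

namespace Slot

variable (P : LParams) (σ : Slot)

/-- **The tiny-fenced open arm event of a slot is increasing.** [folklore] -/
theorem isUpperSet_blackArm : IsUpperSet (σ.blackArm P) := by
  intro ω ω' hle hω
  obtain ⟨zo, uo, hzo, hOut, Fo, hj, h1, h2, hb⟩ := hω
  refine ⟨zo, uo, hzo, openVCrossThrough_mono hle hOut, Fo.mapMono (frameConfig_mono σ.io hle), ?_⟩
  exact ⟨hj, h1, h2, hb⟩

/-- **The tiny-fenced closed arm event of a slot is decreasing.** [folklore] -/
theorem isLowerSet_whiteArm : IsLowerSet (σ.whiteArm P) := by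
  intro ω ω' hle hω
  obtain ⟨zc, uc, hzc, hOut, Fc, hj, h1, h2, hb⟩ := hω
  have hle' : (frameConfig σ.ic ω)ᶜ ≤ (frameConfig σ.ic ω')ᶜ := Set.compl_subset_compl.2 (frameConfig_mono σ.ic hle)
  exact ⟨zc, uc, hzc, openVCrossThrough_mono (negFlip_antitone hle) hOut, Fc.mapMono hle', hj, h1, h2, hb⟩

end Slot

/-- The beacon event is increasing. [folklore] -/
theorem isUpperSet_bcnEvent (i m k : ℕ) (T₀ : ℤ) (w : ℕ) : IsUpperSet (bcnEvent i m k T₀ w) :=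
  isUpperSet_preimage_frameConfig i (isUpperSet_triFrameAt _ _)

/-- **The corridor event is increasing.** [folklore] -/
theorem isUpperSet_corrEvent (i m n k : ℕ) (T₀ : ℤ) (w L ε r e s a len : ℕ) (t : ℤ) (W : ℕ) :
    IsUpperSet (corrEvent i m n k T₀ w L ε r e s a len t W) :=
  ((((isUpperSet_bcnEvent i m k T₀ w).inter (isUpperSet_spokeEvent i m k T₀ w L ε)).inter (isUpperSet_eventAll _)).inter
    (isUpperSet_triHCross _ _ _ _)).inter (isUpperSet_triVCross _ _ _ _)

namespace Slot

variable (P : LParams) (σ : Slot)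

/-- The corridor of the open arm is increasing. [folklore] -/
theorem isUpperSet_blackCorr : IsUpperSet (σ.blackCorr P) := isUpperSet_corrEvent _ _ _ _ _ _ _ _ _ _ _ _ _ _ _

/-- The corridor of the closed arm is decreasing. [folklore] -/
theorem isLowerSet_whiteCorr : IsLowerSet (σ.whiteCorr P) :=
  IsUpperSet.preimage_negFlip (isUpperSet_corrEvent _ _ _ _ _ _ _ _ _ _ _ _ _ _ _)

end Slot

/-! ### Supports -/

/-- **The slot frame box** (tip's frame): `[m - 5k, m - 1] × [T₀ + 1, T₀ + w + 4k]`, containing the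
fence zone's interior part, the fence strip, the beacon and the tip box of every tip of scale `k`
with tip row in the window `[T₀, T₀ + w)`. [cite: Nolin2008, §4.2 Def. 6–7 (arXiv 0711.4948)] -/
def slotFrame (m k : ℕ) (T₀ : ℤ) (w : ℕ) : Finset (Site 2) := triStripFinset ((m : ℤ) - 5 * k) (T₀ + 1) (5 * k - 1) (w + 4 * k - 1)

/-- Membership in the slot frame box (`1 ≤ k`). [folklore] -/
theorem mem_slotFrame {m k : ℕ} (hk : 1 ≤ k) {T₀ : ℤ} {w : ℕ} {v : Site 2} :
    v ∈ slotFrame m k T₀ w ↔ (m : ℤ) - 5 * k ≤ v 0 ∧ v 0 ≤ (m : ℤ) - 1 ∧ T₀ + 1 ≤ v 1 ∧ v 1 ≤ T₀ + w + 4 * k := by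
  rw [slotFrame, ← Finset.mem_coe, coe_triStripFinset, mem_triStrip]
  have h1 : ((5 * k - 1 : ℕ) : ℤ) = 5 * k - 1 := by omega
  have h2 : ((w + 4 * k - 1 : ℕ) : ℤ) = w + 4 * k - 1 := by omega
  rw [h1, h2]; omega

/-- **The shared support** `{m ≤ |v| ≤ R}`. [cite: Nolin2008, §4.3 Lemma 13 (arXiv 0711.4948: Lemma 12, the set `𝒜`)] -/
def sharedFin (m R : ℕ) : Finset (Site 2) := (triBall R).filter fun v => (m : ℤ) ≤ triNorm v

/-- Membership in the shared support. [folklore] -/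
@[simp] theorem mem_sharedFin {m R : ℕ} {v : Site 2} : v ∈ sharedFin m R ↔ (m : ℤ) ≤ triNorm v ∧ triNorm v ≤ R := by
  rw [sharedFin, Finset.mem_filter, mem_triBall_iff]; tauto

/-- **The support of a corridor**: `frameIso i` of the slot frame box and of the spoke's box, the sites
of the arc, the approach box and the target box. [cite: Nolin2008, §4.3 Lemma 13 (arXiv 0711.4948: Lemma 12, the sets `𝒜^±`)] -/
def corrFin (i m n k : ℕ) (T₀ : ℤ) (w L ε r e s a len : ℕ) (t : ℤ) (W : ℕ) : Finset (Site 2) :=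
  (slotFrame m k T₀ w ∪ (spokeTube m k T₀ w L ε).sites).image (frameIso i) ∪ sitesAll (arc (thinRing r e s) a len) ∪
    triStripFinset ((n : ℤ) - (n / 8 : ℕ) + 1) t W (n / 64) ∪
    triStripFinset ((n : ℤ) - (n / 8 : ℕ) + 1) (t - (n / 64 : ℕ)) (n / 8 - 2) (2 * (n / 64))

namespace Slot

variable (P : LParams) (σ : Slot)

/-- **The private support of the open arm of the slot.** [cite: Nolin2008, §4.3 Lemma 13 (arXiv 0711.4948: Lemma 12)] -/
def Pfin : Finset (Site 2) :=
  corrFin σ.io P.m P.n (σ.ko P) (σ.To P) P.w P.LB P.ε P.rB P.e P.s (σ.aB P) P.lenB (σ.tgo P) P.WB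

/-- **The private support of the closed arm of the slot** (the reflection of the support of its
corridor in the colour-exchanged picture). [cite: Nolin2008, §4.3 Lemma 13 (arXiv 0711.4948: Lemma 12)] -/
def Mfin : Finset (Site 2) :=
  (corrFin σ.ic' P.m P.n (σ.kc P) (σ.Tc P) P.w P.LW P.ε P.rW P.e P.s (σ.aW P) (σ.lenW P) (σ.tgc P) P.WW).image Neg.neg

end Slot

/-! ### The corridors are determined by their supports -/

/-- The beacon's square annulus lies in the slot frame box (`2 ≤ k`). [folklore] -/
theorem triSqAnnulusFinset_bcn_subset_slotFrame {m k : ℕ} (hk : 2 ≤ k) (T₀ : ℤ) (w : ℕ) :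
    (↑(triSqAnnulusFinset (bcnCentre m k T₀ w) (k / 2) (2 * (k / 2))) : Set (Site 2)) ⊆ ↑(slotFrame m k T₀ w) := by
  intro v hv
  rw [Finset.mem_coe, mem_triSqAnnulusFinset] at hv
  rw [Finset.mem_coe, mem_slotFrame (by omega)]
  simp only [bcnCentre, site_mk_apply_zero, site_mk_apply_one] at hv
  omega

/-- **The corridor event is determined by its support** (`2 ≤ k`). [folklore] -/
theorem determinedBy_corrEvent {i m n k : ℕ} (hk : 2 ≤ k) (T₀ : ℤ) (w L ε r e s a len : ℕ) (t : ℤ) (W : ℕ) :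
    DeterminedBy (corrEvent i m n k T₀ w L ε r e s a len t W) ↑(corrFin i m n k T₀ w L ε r e s a len t W) := by
  unfold corrEvent corrFin
  have himg : ∀ (B : Finset (Site 2)), (↑(B.image (frameIso i)) : Set (Site 2)) = frameIso i '' ↑B := fun B => Finset.coe_image
  have d1 : DeterminedBy (bcnEvent i m k T₀ w) (frameIso i '' ↑(triSqAnnulusFinset (bcnCentre m k T₀ w) (k / 2) (2 * (k / 2)))) :=
    determinedBy_preimage_frameConfig i (determinedBy_triFrameAt _ _)
  have d2 := determinedBy_spokeEvent i m k T₀ w L ε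
  have d3 := determinedBy_eventAll (arc (thinRing r e s) a len)
  have d4 := determinedBy_triHCross ((n : ℤ) - (n / 8 : ℕ) + 1) t W (n / 64)
  have d5 := determinedBy_triVCross ((n : ℤ) - (n / 8 : ℕ) + 1) (t - (n / 64 : ℕ)) (n / 8 - 2) (2 * (n / 64))
  refine ((((d1.mono ?_).inter (d2.mono ?_)).inter (d3.mono ?_)).inter (d4.mono ?_)).inter (d5.mono ?_)
  · intro v hv
    obtain ⟨u, hu, rfl⟩ := hv
    simp only [Finset.coe_union, Set.mem_union, himg]
    exact Or.inl (Or.inl (Or.inl ⟨u, Or.inl (triSqAnnulusFinset_bcn_subset_slotFrame hk T₀ w hu), rfl⟩))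
  · intro v hv
    obtain ⟨u, hu, rfl⟩ := hv
    simp only [Finset.coe_union, Set.mem_union, himg]
    refine Or.inl (Or.inl (Or.inl ⟨u, Or.inr ?_, rfl⟩))
    rw [coe_sites]; exact hu
  · intro v hv; simp only [Finset.coe_union, Set.mem_union]; exact Or.inl (Or.inl (Or.inr hv))
  · intro v hv; simp only [Finset.coe_union, Set.mem_union]; exact Or.inl (Or.inr hv)
  · intro v hv; simp only [Finset.coe_union, Set.mem_union]; exact Or.inr hv

namespace Slot

variable (P : LParams) (σ : Slot)

/-- **The corridor of the open arm is determined by the private support `Pfin`** (`2 ≤ k₀`). [folklore] -/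
theorem determinedBy_blackCorr (hk : 2 ≤ P.k₀) : DeterminedBy (σ.blackCorr P) ↑(σ.Pfin P) :=
  determinedBy_corrEvent (k := σ.ko P) (le_trans hk (le_trapScale _ _)) _ _ _ _ _ _ _ _ _ _ _

/-- **The corridor of the closed arm is determined by the private support `Mfin`** (`2 ≤ k₀`). [folklore] -/
theorem determinedBy_whiteCorr (hk : 2 ≤ P.k₀) : DeterminedBy (σ.whiteCorr P) ↑(σ.Mfin P) := by
  unfold whiteCorr Mfin
  rw [Finset.coe_image]
  have h := DeterminedBy.preimage_negFlip (determinedBy_corrEvent (i := σ.ic') (m := P.m) (n := P.n) (k := σ.kc P)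
    (le_trans hk (le_trapScale _ _)) (σ.Tc P) P.w P.LW P.ε P.rW P.e P.s (σ.aW P) (σ.lenW P) (σ.tgc P) P.WW)
  refine h.mono ?_
  intro v hv
  exact ⟨-v, hv, neg_neg v⟩

end Slot

/-! ### The arm events are determined by the shared support and the slot frame box -/

/-- The outer free spaces lie in the shared support (`m ≤ N + 1`, `N + N/8 ≤ R`). [folklore] -/
theorem sepOuterFence_subset_sharedFin {m N R : ℕ} (hmN : m ≤ N + 1) (hR : N + N / 8 ≤ R) {z : Site 2} (hz : z ∈ sepLanding N) :
    sepOuterFence N z ⊆ ↑(sharedFin m R) := by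
  intro u hu
  rw [Finset.mem_coe, mem_sharedFin]
  have hlt := lt_triNorm_of_mem_sepOuterFence hu
  rw [mem_sepOuterFence] at hu
  rw [mem_sepLanding] at hz
  have hR' : (N : ℤ) + (N / 8 : ℕ) ≤ R := by exact_mod_cast hR
  exact ⟨by omega, triNorm_le_iff_lin.2 (by omega)⟩

/-- The arm region lies in the shared support (`2m ≤ N`, `N + N/8 ≤ R`). [folklore] -/
theorem extRegion_subset_sharedFin {m N R : ℕ} (hN : 2 * m ≤ N) (hR : N + N / 8 ≤ R) {z : Site 2} (hz : z ∈ sepLanding N) :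
    triAnnulusSet m N ∪ triOpenBall z (N / 8) ⊆ ↑(sharedFin m R) := by
  intro v hv
  rw [Finset.mem_coe, mem_sharedFin]
  refine ⟨norm_le_of_mem_extRegion hN hz v hv, ?_⟩
  have hR' : (N : ℤ) + (N / 8 : ℕ) ≤ R := by exact_mod_cast hR
  rcases hv with hv | hv
  · exact (mem_triAnnulusSet.1 hv).2.trans (by omega)
  · rw [mem_triOpenBall, triNorm_lt_iff_lin] at hv
    rw [mem_sepLanding] at hz
    simp only [Pi.sub_apply] at hv
    exact triNorm_le_iff_lin.2 (by omega)

/-- **Agreement on the shared support and on the framed slot box transports the open arm of a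
slot** (`2m ≤ N`, `N + N/8 ≤ R`, `1 ≤ k₀`). [folklore] -/
theorem Slot.blackArm_of_agree (P : LParams) (σ : Slot) {R : ℕ} (hN : 2 * P.m ≤ P.N) (hR : P.N + P.N / 8 ≤ R) (hio : σ.io < 6)
    (hk₀ : 1 ≤ P.k₀) {ω ω' : SiteConfig (Site 2)}
    (h : ∀ v ∈ (↑(sharedFin P.m R) : Set (Site 2)) ∪ frameIso σ.io '' ↑(slotFrame P.m (σ.ko P) (σ.To P) P.w), v ∈ ω ↔ v ∈ ω')
    (hω : ω ∈ σ.blackArm P) : ω' ∈ σ.blackArm P := by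
  obtain ⟨zo, uo, hzo, hOut, Fo, hj, h1, h2, hb⟩ := hω
  have hko : Fo.k = σ.ko P := by show trapScale P.k₀ Fo.j = trapScale P.k₀ σ.jo; rw [hj]
  have hk1 : 1 ≤ Fo.k := hko ▸ one_le_trapScale hk₀ _
  have hOut' := openVCrossThrough_congr (fun v hv => h v (Or.inl (sepOuterFence_subset_sharedFin (by omega) hR hzo hv))) hOut
  have hm2 : (2 * P.m : ℤ) ≤ 2 * P.N := by have := hN; omega
  refine ⟨zo, uo, hzo, hOut', Fo.congr fun u hu => ?_, ?_⟩
  · -- agreement on the frame sites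
    rw [mem_frameConfig, mem_frameConfig]
    apply h
    rcases hu with ((hu | hu) | hu) | hu
    · obtain ⟨x, hx, rfl⟩ := hu
      rw [RelIso.apply_symm_apply]
      exact Or.inl (extRegion_subset_sharedFin hN hR hzo hx)
    · left
      rw [mem_haSet] at hu
      rw [Finset.mem_coe, mem_sharedFin, triNorm_frameIso σ.io hio]
      have hR' : ((2 * P.m : ℕ) : ℤ) ≤ R := by have : 2 * P.m ≤ R := by omega
                                               exact_mod_cast this
      push_cast at hR'
      exact ⟨hu.2.1, hu.2.2.trans hR'⟩
    · rw [mem_intFrameZone] at hu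
      obtain ⟨hu1, hu2, hu3, hu4, hu5⟩ := hu
      rcases hu1 with hu1 | ⟨hu1, hu1'⟩
      · left
        rw [mem_haSet] at hu1
        rw [Finset.mem_coe, mem_sharedFin, triNorm_frameIso σ.io hio]
        have hR' : ((2 * P.m : ℕ) : ℤ) ≤ R := by have : 2 * P.m ≤ R := by omega
                                                 exact_mod_cast this
        push_cast at hR'
        exact ⟨hu1.2.1, hu1.2.2.trans hR'⟩
      · right
        refine ⟨u, ?_, rfl⟩
        rw [mem_hinSet] at hu1
        have := triNorm_lt_iff_lin.1 hu1.2
        obtain ⟨hz0, -, -⟩ := Fo.z_isIntJ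
        rw [Finset.mem_coe, mem_slotFrame (show 1 ≤ σ.ko P from one_le_trapScale hk₀ _), ← hko]
        omega
    · right
      refine ⟨u, ?_, rfl⟩
      rw [mem_triStrip] at hu
      obtain ⟨hz0, -, -⟩ := Fo.z_isIntJ
      rw [Finset.mem_coe, mem_slotFrame (show 1 ≤ σ.ko P from one_le_trapScale hk₀ _), ← hko]
      omega
  · exact ⟨hj, h1, h2, hb⟩

/-- **The open arm event of a slot is determined by the shared support and the framed slot box.** [cite: Nolin2008, §4.3 Lemma 13 (arXiv 0711.4948: Lemma 12)] -/
theorem Slot.determinedBy_blackArm (P : LParams) (σ : Slot) {R : ℕ} (hN : 2 * P.m ≤ P.N) (hR : P.N + P.N / 8 ≤ R) (hio : σ.io < 6)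
    (hk₀ : 1 ≤ P.k₀) :
    DeterminedBy (σ.blackArm P) ((↑(sharedFin P.m R) : Set (Site 2)) ∪ frameIso σ.io '' ↑(slotFrame P.m (σ.ko P) (σ.To P) P.w)) := by
  rw [determinedBy_iff]
  intro ω ω' hω
  have h : ∀ v ∈ (↑(sharedFin P.m R) : Set (Site 2)) ∪ frameIso σ.io '' ↑(slotFrame P.m (σ.ko P) (σ.To P) P.w), v ∈ ω ↔ v ∈ ω' :=
    fun v hv => by
      constructor
      · intro hvω; have : v ∈ ω ∩ _ := ⟨hvω, hv⟩; rw [hω] at this; exact this.1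
      · intro hvω; have : v ∈ ω' ∩ _ := ⟨hvω, hv⟩; rw [← hω] at this; exact this.1
  exact ⟨Slot.blackArm_of_agree P σ hN hR hio hk₀ h, Slot.blackArm_of_agree P σ hN hR hio hk₀ fun v hv => (h v hv).symm⟩

/-- **Agreement on the shared support and on the framed slot box transports the closed arm of a slot.** [folklore] -/
theorem Slot.whiteArm_of_agree (P : LParams) (σ : Slot) {R : ℕ} (hN : 2 * P.m ≤ P.N) (hR : P.N + P.N / 8 ≤ R) (hic : σ.ic < 6)
    (hk₀ : 1 ≤ P.k₀) {ω ω' : SiteConfig (Site 2)}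
    (h : ∀ v ∈ (↑(sharedFin P.m R) : Set (Site 2)) ∪ frameIso σ.ic '' ↑(slotFrame P.m (σ.kc P) (σ.Tc P) P.w), v ∈ ω ↔ v ∈ ω')
    (hω : ω ∈ σ.whiteArm P) : ω' ∈ σ.whiteArm P := by
  obtain ⟨zc, uc, hzc, hOut, Fc, hj, h1, h2, hb⟩ := hω
  have hkc : Fc.k = σ.kc P := by show trapScale P.k₀ Fc.j = trapScale P.k₀ σ.jc; rw [hj]
  have hk1 : 1 ≤ Fc.k := hkc ▸ one_le_trapScale hk₀ _
  have hm2 : (2 * P.m : ℤ) ≤ 2 * P.N := by have := hN; omega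
  have hneg : ∀ v : Site 2, -v ∈ (↑(sharedFin P.m R) : Set (Site 2)) → (v ∈ negFlip ω ↔ v ∈ negFlip ω') := fun v hv => by
    rw [mem_negFlip, mem_negFlip, h (-v) (Or.inl hv)]
  have hOut' : OpenVCrossThrough (sepOuterFence P.N zc) (zc 1 - (P.N / 64 : ℕ)) (zc 1 + (P.N / 64 : ℕ)) (negFlip ω') uc :=
    openVCrossThrough_congr (fun v hv => hneg v ?_) hOut
  swap
  · -- `-v` has the same norm
    have := sepOuterFence_subset_sharedFin (m := P.m) (by omega) hR hzc hv
    rw [Finset.mem_coe, mem_sharedFin] at this ⊢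
    rwa [triNorm_neg]
  refine ⟨zc, uc, hzc, hOut', Fc.congr fun u hu => ?_, hj, h1, h2, hb⟩
  rw [Set.mem_compl_iff, Set.mem_compl_iff, mem_frameConfig, mem_frameConfig, not_iff_not]
  apply h
  rcases hu with ((hu | hu) | hu) | hu
  · obtain ⟨x, hx, rfl⟩ := hu
    rw [RelIso.apply_symm_apply]
    left
    have := extRegion_subset_sharedFin hN hR hzc hx
    rw [Finset.mem_coe, mem_sharedFin] at this ⊢
    rwa [triNorm_neg] at this
  · left
    rw [mem_haSet] at hu
    rw [Finset.mem_coe, mem_sharedFin, triNorm_frameIso σ.ic hic]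
    have hR' : ((2 * P.m : ℕ) : ℤ) ≤ R := by have : 2 * P.m ≤ R := by omega
                                             exact_mod_cast this
    push_cast at hR'
    exact ⟨hu.2.1, hu.2.2.trans hR'⟩
  · rw [mem_intFrameZone] at hu
    obtain ⟨hu1, hu2, hu3, hu4, hu5⟩ := hu
    rcases hu1 with hu1 | ⟨hu1, hu1'⟩
    · left
      rw [mem_haSet] at hu1
      rw [Finset.mem_coe, mem_sharedFin, triNorm_frameIso σ.ic hic]
      have hR' : ((2 * P.m : ℕ) : ℤ) ≤ R := by have : 2 * P.m ≤ R := by omega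
                                               exact_mod_cast this
      push_cast at hR'
      exact ⟨hu1.2.1, hu1.2.2.trans hR'⟩
    · right
      refine ⟨u, ?_, rfl⟩
      rw [mem_hinSet] at hu1
      have := triNorm_lt_iff_lin.1 hu1.2
      obtain ⟨hz0, -, -⟩ := Fc.z_isIntJ
      rw [Finset.mem_coe, mem_slotFrame (show 1 ≤ σ.kc P from one_le_trapScale hk₀ _), ← hkc]
      omega
  · right
    refine ⟨u, ?_, rfl⟩
    rw [mem_triStrip] at hu
    obtain ⟨hz0, -, -⟩ := Fc.z_isIntJ
    rw [Finset.mem_coe, mem_slotFrame (show 1 ≤ σ.kc P from one_le_trapScale hk₀ _), ← hkc]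
    omega

/-- **The closed arm event of a slot is determined by the shared support and the framed slot box.** [cite: Nolin2008, §4.3 Lemma 13 (arXiv 0711.4948: Lemma 12)] -/
theorem Slot.determinedBy_whiteArm (P : LParams) (σ : Slot) {R : ℕ} (hN : 2 * P.m ≤ P.N) (hR : P.N + P.N / 8 ≤ R) (hic : σ.ic < 6)
    (hk₀ : 1 ≤ P.k₀) :
    DeterminedBy (σ.whiteArm P) ((↑(sharedFin P.m R) : Set (Site 2)) ∪ frameIso σ.ic '' ↑(slotFrame P.m (σ.kc P) (σ.Tc P) P.w)) := by
  rw [determinedBy_iff]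
  intro ω ω' hω
  have h : ∀ v ∈ (↑(sharedFin P.m R) : Set (Site 2)) ∪ frameIso σ.ic '' ↑(slotFrame P.m (σ.kc P) (σ.Tc P) P.w), v ∈ ω ↔ v ∈ ω' :=
    fun v hv => by
      constructor
      · intro hvω; have : v ∈ ω ∩ _ := ⟨hvω, hv⟩; rw [hω] at this; exact this.1
      · intro hvω; have : v ∈ ω' ∩ _ := ⟨hvω, hv⟩; rw [← hω] at this; exact this.1
  exact ⟨Slot.whiteArm_of_agree P σ hN hR hic hk₀ h, Slot.whiteArm_of_agree P σ hN hR hic hk₀ fun v hv => (h v hv).symm⟩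

end Literature.Probability.Percolation
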